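import Summits.QuantumFields.BalabanUV.T4Continuum.Support.VariationalColourTaxiTransport
import Summits.QuantumFields.BalabanUV.T4Continuum.Support.VariationalVectorOneStepPhys
import Summits.QuantumFields.BalabanUV.T4Continuum.Support.VariationalVectorWeitzenbock

/-!
# T⁴ programme, spine node NE2 (U1a), lane P2 — «V-AVG-G», file 7: DIV-AVG WITH BACKGROUND, THE POINTWISE BOUND — the commutator of the COVARIANT divergence
# with the line average (product line carriers `T₀′ ∘ Π`) against `L`× the transported block mean is, line by line, a window of transported SECOND covariant
# differences + the across-block line mismatch `misL` × (FIRST differences and the field) (model level; cell `pub-balaban`)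

NE2 formalisation swarm `b2b-balaban-t4-ne2-formalise-*`, leaf prover 10 GEN 4 (`prover-b2b-balaban-t4-ne2-formalise-leaf-10-g4-0`, V-END holder lineage); item
«V-AVG-G: THE LOWER BRACKET WITHOUT A SLICE MOVE» (CLAIMS.log 2026-08-20 l.19093 ∕ l.19718 ∕ l.19946), file 7.  On top of leaf-01-g5's `VariationalVectorFederbush`
(p216586: `misL`, `line_decomp`, `cdV_QvL_eq`, `line_telescope`), `VariationalVectorFederbushLine` (`lineT`), the colour road's `piTv` ∕ `piTv_add` ∕ `piTv_mem_unitary`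
(`VariationalColourFederbush`, `VariationalColourTaxiTransport`), `divV` (`VariationalVectorWeitzenbock`) BY NAME; nothing defined.

THE STATEMENT (model level; `E` a Hilbert space; block side `L`, coarse torus `Tor N`, fine torus `Tor (fine L N)`).  DATA: UNITARY coarse bonds `Rc`, fine bonds `R′`
and site transports `T₀′`; the line carriers are the PRODUCT carriers `T = lineT T₀′ R′` (`T(y,j,t,ν) = T₀′(L·y+j) ∘ Π^ν_t(L·y+j)` — the road's taxi tower); the
across-block LINE MISMATCH of `VariationalVectorFederbush` in the line's own direction, which for the product carriers IS FED⁺'s SITE MISMATCH transported along the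
line (`misL_lineT_self`: `misL Rc R′ T y j t μ μ = misv Rc R′ T₀′ y μ j ∘ Π_t`), so the theorems take the scalar Federbush datum `‖misv Rc R′ T₀′ y μ j‖ ≤ m` (`= 0` at flat data).
For a fine 1-form `W` write `F_μ(z) = (D_μW_μ)(z) = cdV R′ W z μ μ` and `F₂_μ(z) = (D_μF_μ)(z)` (the diagonal covariant second difference).  THEN
 * §1 `DirAdjv_eq_neg_star_cDv` ∕ `divV_eq_neg_sum` — with unitary bonds the divergence is `div_R W(x) = −Σ_μ R(x−e_μ,μ)⋆((D_μW_μ)(x − e_μ))`;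
 * §2 **`transport_identity`** — the KEY TRANSPORT IDENTITY: for `t < L`, `s₀ = L − 1 − t`, `y′ = y − e_μ`, `p′ = L·y′ + j + t e_μ` (so `p′ + s₀ e_μ = L·y + j − e_μ`):
   `Rc(y′,μ)⋆ ∘ T(y′,j,t,μ) ∘ Π^μ_{s₀}(p′) = T₀′(L·y+j) ∘ R′(L·y+j−e_μ, μ)⋆ − Rc(y′,μ)⋆ ∘ misL(y′,j,t;μ,μ) ∘ (Π^μ_{t+1}(L·y+j−e_μ))⋆`
   — the comb transport of the fine point `L·y + j − e_μ` through the neighbouring block's frame and the coarse bond IS the direct transport through this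
   block's frame, up to the line mismatch (unitarity: `Π⋆Π = 1`, `Rc⋆Rc = 1`; `Π_{s₀+t+1} = Π_{s₀} ∘ Π_{t+1}`, `Π_{t+1}(q) = R′(q) ∘ Π_t(q + e_μ)`);
 * §3 **`norm_divAvg_cov_le`** — THE POINTWISE BOUND:
   `‖div_{Rc}(Q_T W)(y) − L•Q_{T₀′}(div_{R′} W)(y)‖ ≤ (L^{d+1})⁻¹ · Σ_μ Σ_j Σ_{t<L} ( 2L·Σ_{r<L} ‖F₂_μ(p′ + r e_μ)‖ + L·m·‖F_μ(L·y+j−e_μ)‖ + m·‖W(L·y+j+t e_μ, μ)‖ )`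
   (`cdV_QvL_eq` + `line_decomp` with `ν = μ` for the coarse difference of the average at `y − e_μ`; every line telescopes (`line_telescope` applied to the
   1-form `(z,ν) ↦ cdV R′ W z μ ν`) against its OWN point `L·y+j−e_μ` = the point where `L•Q₀(div′ W)` reads `F_μ`; §2 prices the two frames of that point).
At flat data (`m = 0`) this is file 6's window of second differences (`VariationalVectorDivAvgFlat`); the square sums, the block bijection and the END units
(`ε_D = √(3d)·(2∕n + m + n·m)`-shape against `hessV ∕ diagonal gradient ∕ qVV`) are file 8.

HONEST FRAMING (T4-DAG p. 1).  Model level (bond ∕ site transports DATA, product line carriers; c5 — no identification with Bałaban's `R_k(U)`); [folklore] covariant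
telescoping + unitary algebra; nothing printed is a hypothesis; no `def`, no `def … : Prop`, no `sorry`; axioms standard.  This is the pointwise half of DIV-AVG with
background; the END-unit statement (file 8) and the sizes of `m` for the taxi class are NOT here; V-END with background ∕ NE2 NOT proved; NE3 OPEN; spine PROVED 0∕9
unchanged; rung (B)+1 on a fixed finite T⁴ — NOT infinite volume, NOT mass gap, NOT Clay.  HONEST DEPENDENCY (cell, verbatim): continuum YM on T⁴ ⇐ BetaPertH ∧ nine
spine estimates (0/9 proved); BetaPertH ⇐ (D1) ∧ (D4) ∧ CAP+tail; G-an2-4 gates asym, D1 and NE2/3/4.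
-/

noncomputable section

namespace Summit.QuantumFields.BalabanUV.T4Continuum.VariationalVectorDivAvgCovariant

open Finset
open Literature.MathematicalPhysics.QuantumFieldTheory.Balaban1983to89.B5Prop11Plancherel (Tor fine unitVec)
open Literature.MathematicalPhysics.QuantumFieldTheory.Balaban1983to89.B5Block118 (tstep tstep_zero tstep_succ bpt bpt_add_tstep)
open Summit.QuantumFields.BalabanUV.T4Continuum.VariationalColourFederbush (cDv Qcv piTv misv norm_piTv_le_one norm_le_one_of_mem_unitary)
open Summit.QuantumFields.BalabanUV.T4Continuum.VariationalColourBochner (DirAdjv)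
open Summit.QuantumFields.BalabanUV.T4Continuum.VariationalColourTaxiTransport (piTv_add piTv_mem_unitary)
open Summit.QuantumFields.BalabanUV.T4Continuum.VectorBlockTrialForm (QvL)
open Summit.QuantumFields.BalabanUV.T4Continuum.VariationalVectorForm (cdV)
open Summit.QuantumFields.BalabanUV.T4Continuum.VariationalVectorFederbush (misL lineT line_decomp cdV_QvL_eq line_telescope)
open Summit.QuantumFields.BalabanUV.T4Continuum.VariationalVectorWeitzenbock (divV divV_apply)

variable {d : ℕ} {E : Type*} [NormedAddCommGroup E] [InnerProductSpace ℂ E] [CompleteSpace E]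

/-! ## §1 The divergence with unitary bonds through FORWARD covariant differences -/

section Divergence

variable {P : Fin d → ℕ} [∀ μ, NeZero (P μ)]

omit [∀ μ, NeZero (P μ)] in
/-- **with unitary bonds the backward covariant difference is minus the transported forward one**:
`DirAdjv R μ f x = −R(x−e_μ,μ)⋆ (cDv R f (x − e_μ) μ)`. [folklore] -/
theorem DirAdjv_eq_neg_star_cDv (R : Tor P → Fin d → (E →L[ℂ] E)) (hR : ∀ x μ, R x μ ∈ unitary (E →L[ℂ] E)) (μ : Fin d) (f : Tor P → E) (x : Tor P) :
    DirAdjv P R μ f x = -(star (R (x - unitVec P μ) μ) (cDv P R f (x - unitVec P μ) μ)) := by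
  unfold DirAdjv cDv
  -- `U⋆ (U v) = v` for the unitary bond (leaf-02's `VariationalColourRegularity.star_apply_apply`, inlined to keep the import list short)
  rw [sub_add_cancel, map_sub, ← mul_apply_eq_comp, Unitary.star_mul_self_of_mem (hR _ _), one_apply_eq_self]
  abel

omit [∀ μ, NeZero (P μ)] in
/-- hence **`div_R W(x) = −Σ_μ R(x−e_μ,μ)⋆((D_μW_μ)(x − e_μ))`** (`cdV R W z μ μ = cDv R (W·μ) z μ` definitionally). [folklore] -/
theorem divV_eq_neg_sum (R : Tor P → Fin d → (E →L[ℂ] E)) (hR : ∀ x μ, R x μ ∈ unitary (E →L[ℂ] E)) (W : Tor P → Fin d → E) (x : Tor P) :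
    divV P R W x = -∑ μ, star (R (x - unitVec P μ) μ) (cdV P R W (x - unitVec P μ) μ μ) := by
  unfold divV
  rw [← sum_neg_distrib]
  exact sum_congr rfl fun μ _ => DirAdjv_eq_neg_star_cDv R hR μ _ x

end Divergence

/-! ## §2 The key transport identity: two frames for the point `L·y + j − e_μ` -/

section Transport

variable (L : ℕ) [NeZero L] (N : Fin d → ℕ) [hN : ∀ μ, NeZero (N μ)]
variable {Rc : Tor N → Fin d → (E →L[ℂ] E)} {R' : Tor (fine L N) → Fin d → (E →L[ℂ] E)} {T₀ : Tor (fine L N) → (E →L[ℂ] E)}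

omit [NeZero L] hN in
/-- the point bookkeeping: `p′ + s₀ e_μ = L·y + j − e_μ` for `p′ = L·(y − e_μ) + j + t e_μ`, `s₀ + t + 1 = L`. [folklore] -/
theorem point_eq (y : Tor N) (j : Fin d → Fin L) (μ : Fin d) {t s₀ : ℕ} (hts : s₀ + (t + 1) = L) :
    bpt L N (y - unitVec N μ) j + tstep (fine L N) μ t + tstep (fine L N) μ s₀ = bpt L N y j - unitVec (fine L N) μ := by
  have h := bpt_add_tstep L N (y - unitVec N μ) j μ
  rw [sub_add_cancel] at h
  -- `tstep t + tstep s₀ + e = tstep L`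
  have hsum : tstep (fine L N) μ t + tstep (fine L N) μ s₀ + unitVec (fine L N) μ = tstep (fine L N) μ L := by
    rw [← hts, show s₀ + (t + 1) = (t + s₀) + 1 by omega, tstep_succ]
    congr 1
    funext ν
    by_cases hν : ν = μ
    · subst hν; simp [tstep, Nat.cast_add]
    · simp [tstep, hν]
  rw [← h, eq_sub_iff_add_eq, add_assoc, add_assoc, ← add_assoc (tstep (fine L N) μ t), hsum]

omit [NeZero L] hN in
/-- the line's own point of the block: `p′ + L e_μ = L·y + j + t e_μ`. [folklore] -/
theorem point_eq' (y : Tor N) (j : Fin d → Fin L) (μ : Fin d) (t : ℕ) :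
    bpt L N (y - unitVec N μ) j + tstep (fine L N) μ t + tstep (fine L N) μ L = bpt L N y j + tstep (fine L N) μ t := by
  have h := bpt_add_tstep L N (y - unitVec N μ) j μ
  rw [sub_add_cancel] at h
  rw [← h]
  abel

omit [CompleteSpace E] [NeZero L] hN in
/-- **THE LINE MISMATCH OF THE PRODUCT CARRIERS IN THE LINE's OWN DIRECTION IS FED⁺'s SITE MISMATCH** (transported along the line):
`misL Rc R′ (lineT T₀′ R′) y j t μ μ = misv Rc R′ T₀′ y μ j ∘ Π_t(L·(y+e_μ)+j)` (`Π_t(b)∘Π_L(b+te_μ) = Π_{t+L}(b) = Π_L(b)∘Π_t(b+Le_μ)`, `b + Le_μ = L·(y+e_μ)+j`). [folklore] -/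
theorem misL_lineT_self (Rc : Tor N → Fin d → (E →L[ℂ] E)) (R' : Tor (fine L N) → Fin d → (E →L[ℂ] E)) (T₀ : Tor (fine L N) → (E →L[ℂ] E))
    (y : Tor N) (j : Fin d → Fin L) (t : Fin L) (μ : Fin d) :
    misL L N Rc R' (lineT L N T₀ R') y j t μ μ = misv L N Rc R' T₀ y μ j * piTv L N R' (bpt L N (y + unitVec N μ) j) μ t := by
  simp only [misL, lineT, misv]
  rw [mul_assoc (T₀ (bpt L N y j)), ← piTv_add, Nat.add_comm (t : ℕ) L, piTv_add, bpt_add_tstep, sub_mul]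
  simp only [mul_assoc]

omit [NeZero L] hN in
/-- hence FED⁺'s datum `‖misv Rc R′ T₀′ y μ j‖ ≤ m` bounds the line mismatch: `‖misL Rc R′ (lineT T₀′ R′) y j t μ μ‖ ≤ m` (contractive `R′`). [folklore] -/
theorem norm_misL_lineT_self_le {Rc : Tor N → Fin d → (E →L[ℂ] E)} {R' : Tor (fine L N) → Fin d → (E →L[ℂ] E)} {T₀ : Tor (fine L N) → (E →L[ℂ] E)}
    (hR' : ∀ x μ, ‖R' x μ‖ ≤ 1) {m : ℝ} (hmis : ∀ y μ j, ‖misv L N Rc R' T₀ y μ j‖ ≤ m) (y : Tor N) (j : Fin d → Fin L) (t : Fin L) (μ : Fin d) :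
    ‖misL L N Rc R' (lineT L N T₀ R') y j t μ μ‖ ≤ m := by
  have hm0 : 0 ≤ m := le_trans (norm_nonneg _) (hmis y μ j)
  rw [misL_lineT_self]
  calc _ ≤ ‖misv L N Rc R' T₀ y μ j‖ * ‖piTv L N R' (bpt L N (y + unitVec N μ) j) μ t‖ := norm_mul_le _ _
    _ ≤ m * 1 := mul_le_mul (hmis y μ j) (norm_piTv_le_one L N hR' _ _ _) (norm_nonneg _) hm0
    _ = m := mul_one m

omit [NeZero L] hN in
/-- **THE KEY TRANSPORT IDENTITY** (unitary data, product line carriers): for `t < L`, `s₀ + (t+1) = L`, `y′ = y − e_μ`, `p′ = L·y′ + j + t e_μ`,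
`Rc(y′,μ)⋆ ∘ T(y′,j,t,μ) ∘ Π_{s₀}(p′) = T₀′(L·y+j) ∘ R′(L·y+j−e_μ,μ)⋆ − Rc(y′,μ)⋆ ∘ misL(y′,j,t;μ,μ) ∘ (Π_{t+1}(L·y+j−e_μ))⋆`. [folklore] -/
theorem transport_identity (hRc : ∀ y μ, Rc y μ ∈ unitary (E →L[ℂ] E)) (hR' : ∀ x μ, R' x μ ∈ unitary (E →L[ℂ] E))
    (y : Tor N) (j : Fin d → Fin L) (μ : Fin d) (t : Fin L) {s₀ : ℕ} (hts : s₀ + ((t : ℕ) + 1) = L) :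
    star (Rc (y - unitVec N μ) μ) * lineT L N T₀ R' (y - unitVec N μ) j t μ * piTv L N R' (bpt L N (y - unitVec N μ) j + tstep (fine L N) μ t) μ s₀
      = T₀ (bpt L N y j) * star (R' (bpt L N y j - unitVec (fine L N) μ) μ)
        - star (Rc (y - unitVec N μ) μ) * misL L N Rc R' (lineT L N T₀ R') (y - unitVec N μ) j t μ μ
            * star (piTv L N R' (bpt L N y j - unitVec (fine L N) μ) μ ((t : ℕ) + 1)) := by
  set y' := y - unitVec N μ with hy'
  set p' := bpt L N y' j + tstep (fine L N) μ t with hp'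
  set q₀ := bpt L N y j - unitVec (fine L N) μ with hq₀
  have hpq : p' + tstep (fine L N) μ s₀ = q₀ := point_eq L N y j μ hts
  have hq₀b : q₀ + tstep (fine L N) μ 1 = bpt L N y j := by
    rw [hq₀, show (1 : ℕ) = 0 + 1 from rfl, tstep_succ, tstep_zero, zero_add, sub_add_cancel]
  -- `Π_L(p′) = Π_{s₀}(p′) ∘ Π_{t+1}(q₀)` and `Π_{t+1}(q₀) = R′(q₀) ∘ Π_t(L·y+j)`
  have hsplit : piTv L N R' p' μ L = piTv L N R' p' μ s₀ * piTv L N R' q₀ μ ((t : ℕ) + 1) := by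
    have h := piTv_add L N R' p' μ s₀ ((t : ℕ) + 1)
    rwa [hts, hpq] at h
  have hfirst : piTv L N R' q₀ μ ((t : ℕ) + 1) = R' q₀ μ * piTv L N R' (bpt L N y j) μ t := by
    rw [Nat.add_comm (t : ℕ) 1, piTv_add, hq₀b]
    simp [piTv, tstep_zero]
  -- (M1): `T(y′)∘Π_L(p′) = Rc(y′)∘T(y) − misL`
  have hyy : y' + unitVec N μ = y := by rw [hy', sub_add_cancel]
  have hM1 : lineT L N T₀ R' y' j t μ * piTv L N R' p' μ L = Rc y' μ * lineT L N T₀ R' y j t μ - misL L N Rc R' (lineT L N T₀ R') y' j t μ μ := by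
    simp only [misL, hp', hyy]
    abel
  -- unitarity
  have hU1 : star (Rc y' μ) * Rc y' μ = 1 := (Unitary.mem_iff.mp (hRc y' μ)).1
  have hU2 : piTv L N R' q₀ μ ((t : ℕ) + 1) * star (piTv L N R' q₀ μ ((t : ℕ) + 1)) = 1 :=
    (Unitary.mem_iff.mp (piTv_mem_unitary L N hR' q₀ μ _)).2
  have hU3 : piTv L N R' (bpt L N y j) μ t * star (piTv L N R' (bpt L N y j) μ t) = 1 :=
    (Unitary.mem_iff.mp (piTv_mem_unitary L N hR' (bpt L N y j) μ _)).2
  -- `X ∘ Π_{t+1}(q₀) = T(y) − Rc⋆∘misL` for `X = Rc⋆ ∘ T(y′) ∘ Π_{s₀}(p′)`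
  have hX : star (Rc y' μ) * lineT L N T₀ R' y' j t μ * piTv L N R' p' μ s₀ * piTv L N R' q₀ μ ((t : ℕ) + 1)
      = lineT L N T₀ R' y j t μ - star (Rc y' μ) * misL L N Rc R' (lineT L N T₀ R') y' j t μ μ := by
    calc star (Rc y' μ) * lineT L N T₀ R' y' j t μ * piTv L N R' p' μ s₀ * piTv L N R' q₀ μ ((t : ℕ) + 1)
        = star (Rc y' μ) * (lineT L N T₀ R' y' j t μ * piTv L N R' p' μ L) := by rw [hsplit]; simp only [mul_assoc]
      _ = star (Rc y' μ) * (Rc y' μ * lineT L N T₀ R' y j t μ - misL L N Rc R' (lineT L N T₀ R') y' j t μ μ) := by rw [hM1]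
      _ = _ := by rw [mul_sub, ← mul_assoc, hU1, one_mul]
  -- `T(y) ∘ Π_{t+1}(q₀)⋆ = T₀′(L·y+j) ∘ R′(q₀)⋆`
  have hTy : lineT L N T₀ R' y j t μ * star (piTv L N R' q₀ μ ((t : ℕ) + 1)) = T₀ (bpt L N y j) * star (R' q₀ μ) := by
    rw [hfirst, star_mul]
    simp only [lineT]
    rw [mul_assoc, ← mul_assoc (piTv L N R' (bpt L N y j) μ t), hU3, one_mul]
  calc star (Rc y' μ) * lineT L N T₀ R' y' j t μ * piTv L N R' p' μ s₀
      = star (Rc y' μ) * lineT L N T₀ R' y' j t μ * piTv L N R' p' μ s₀ * (piTv L N R' q₀ μ ((t : ℕ) + 1) * star (piTv L N R' q₀ μ ((t : ℕ) + 1))) := by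
        rw [hU2, mul_one]
    _ = (star (Rc y' μ) * lineT L N T₀ R' y' j t μ * piTv L N R' p' μ s₀ * piTv L N R' q₀ μ ((t : ℕ) + 1)) * star (piTv L N R' q₀ μ ((t : ℕ) + 1)) := by
        rw [← mul_assoc]
    _ = (lineT L N T₀ R' y j t μ - star (Rc y' μ) * misL L N Rc R' (lineT L N T₀ R') y' j t μ μ) * star (piTv L N R' q₀ μ ((t : ℕ) + 1)) := by rw [hX]
    _ = _ := by rw [sub_mul, hTy]

end Transport

/-! ## §3 The pointwise bound -/

section Pointwise

variable (L : ℕ) [NeZero L] (N : Fin d → ℕ) [hN : ∀ μ, NeZero (N μ)]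
variable {Rc : Tor N → Fin d → (E →L[ℂ] E)} {R' : Tor (fine L N) → Fin d → (E →L[ℂ] E)} {T₀ : Tor (fine L N) → (E →L[ℂ] E)}

omit [CompleteSpace E] [NeZero L] hN in
/-- the line telescoping for the 1-form `(z,ν) ↦ cdV R′ W z μ ν`: for `s, s₀ ≤ L`,
`‖Π_s(p)(F_μ(p + s e_μ)) − Π_{s₀}(p)(F_μ(p + s₀ e_μ))‖ ≤ 2·Σ_{r<L} ‖F₂_μ(p + r e_μ)‖`, `F₂_μ(z) = cdV R′ (cdV R′ W · μ ·) z μ μ`. [folklore] -/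
theorem norm_line_window_le (hR' : ∀ x μ, ‖R' x μ‖ ≤ 1) (W : Tor (fine L N) → Fin d → E) (p : Tor (fine L N)) (μ : Fin d) {s s₀ : ℕ} (hs : s ≤ L)
    (hs₀ : s₀ ≤ L) :
    ‖piTv L N R' p μ s (cdV (fine L N) R' W (p + tstep (fine L N) μ s) μ μ) - piTv L N R' p μ s₀ (cdV (fine L N) R' W (p + tstep (fine L N) μ s₀) μ μ)‖
      ≤ 2 * ∑ r ∈ range L, ‖cdV (fine L N) R' (fun z ν => cdV (fine L N) R' W z μ ν) (p + tstep (fine L N) μ r) μ μ‖ := by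
  have htel : ∀ u : ℕ, piTv L N R' p μ u (cdV (fine L N) R' W (p + tstep (fine L N) μ u) μ μ)
      = cdV (fine L N) R' W p μ μ + ∑ r ∈ range u, piTv L N R' p μ r (cdV (fine L N) R' (fun z ν => cdV (fine L N) R' W z μ ν) (p + tstep (fine L N) μ r) μ μ) := by
    intro u
    have h := line_telescope L N R' (fun z ν => cdV (fine L N) R' W z μ ν) p μ μ u
    rw [← h]
    abel
  have hpart : ∀ u : ℕ, u ≤ L → ‖∑ r ∈ range u, piTv L N R' p μ r (cdV (fine L N) R' (fun z ν => cdV (fine L N) R' W z μ ν) (p + tstep (fine L N) μ r) μ μ)‖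
      ≤ ∑ r ∈ range L, ‖cdV (fine L N) R' (fun z ν => cdV (fine L N) R' W z μ ν) (p + tstep (fine L N) μ r) μ μ‖ := by
    intro u hu
    refine (norm_sum_le _ _).trans ((sum_le_sum fun r _ => ?_).trans
      (sum_le_sum_of_subset_of_nonneg (fun x hx => mem_range.mpr (lt_of_lt_of_le (mem_range.mp hx) hu)) fun _ _ _ => norm_nonneg _))
    exact (ContinuousLinearMap.le_opNorm _ _).trans ((mul_le_mul_of_nonneg_right (norm_piTv_le_one L N hR' _ _ _) (norm_nonneg _)).trans (by rw [one_mul]))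
  rw [htel s, htel s₀, add_sub_add_left_eq_sub]
  calc _ ≤ ‖∑ r ∈ range s, piTv L N R' p μ r (cdV (fine L N) R' (fun z ν => cdV (fine L N) R' W z μ ν) (p + tstep (fine L N) μ r) μ μ)‖
        + ‖∑ r ∈ range s₀, piTv L N R' p μ r (cdV (fine L N) R' (fun z ν => cdV (fine L N) R' W z μ ν) (p + tstep (fine L N) μ r) μ μ)‖ := norm_sub_le _ _
    _ ≤ _ := by linarith [hpart s hs, hpart s₀ hs₀]

omit [NeZero L] hN in
/-- **THE SUMMAND IDENTITY** (one line `(μ, j, t)`): with `U = Rc(y′,μ)⋆`, `Tref = T₀′(L·y+j) ∘ R′(L·y+j−e_μ)⋆`, `q₀ = p′ + s₀ e_μ = L·y+j−e_μ`,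
`Σ_{s<L} Tref(F(q₀)) − U(T(y′,j,t,μ)(Σ_{s<L} Π_s(p′)F(p′+se_μ)) + Mis(w))
  = Σ_{s<L} ( U(T(y′,j,t,μ)(Π_{s₀}(p′)F(p′+s₀e_μ) − Π_s(p′)F(p′+se_μ))) + U(Mis(Π_{t+1}(q₀)⋆ F(q₀))) ) − U(Mis(w))` — §2 applied to vectors. [folklore] -/
theorem summand_eq (hRc : ∀ y μ, Rc y μ ∈ unitary (E →L[ℂ] E)) (hR' : ∀ x μ, R' x μ ∈ unitary (E →L[ℂ] E))
    (y : Tor N) (j : Fin d → Fin L) (μ : Fin d) (t : Fin L) {s₀ : ℕ} (hts : s₀ + ((t : ℕ) + 1) = L) (F : Tor (fine L N) → E) (w : E) :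
    (∑ _s ∈ range L, (T₀ (bpt L N y j) * star (R' (bpt L N y j - unitVec (fine L N) μ) μ)) (F (bpt L N y j - unitVec (fine L N) μ)))
      - star (Rc (y - unitVec N μ) μ) (lineT L N T₀ R' (y - unitVec N μ) j t μ
          (∑ s ∈ range L, piTv L N R' (bpt L N (y - unitVec N μ) j + tstep (fine L N) μ t) μ s (F (bpt L N (y - unitVec N μ) j + tstep (fine L N) μ t + tstep (fine L N) μ s)))
          + misL L N Rc R' (lineT L N T₀ R') (y - unitVec N μ) j t μ μ w)
      = (∑ s ∈ range L, (star (Rc (y - unitVec N μ) μ) (lineT L N T₀ R' (y - unitVec N μ) j t μ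
            (piTv L N R' (bpt L N (y - unitVec N μ) j + tstep (fine L N) μ t) μ s₀ (F (bpt L N (y - unitVec N μ) j + tstep (fine L N) μ t + tstep (fine L N) μ s₀))
              - piTv L N R' (bpt L N (y - unitVec N μ) j + tstep (fine L N) μ t) μ s (F (bpt L N (y - unitVec N μ) j + tstep (fine L N) μ t + tstep (fine L N) μ s))))
          + star (Rc (y - unitVec N μ) μ) (misL L N Rc R' (lineT L N T₀ R') (y - unitVec N μ) j t μ μ
              (star (piTv L N R' (bpt L N y j - unitVec (fine L N) μ) μ ((t : ℕ) + 1)) (F (bpt L N y j - unitVec (fine L N) μ))))))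
        - star (Rc (y - unitVec N μ) μ) (misL L N Rc R' (lineT L N T₀ R') (y - unitVec N μ) j t μ μ w) := by
  have hid := transport_identity L N (T₀ := T₀) hRc hR' y j μ t hts
  have hpq : bpt L N (y - unitVec N μ) j + tstep (fine L N) μ t + tstep (fine L N) μ s₀ = bpt L N y j - unitVec (fine L N) μ := point_eq L N y j μ hts
  -- `Tref v = U (T(y′) (Π_{s₀} v')) + U (Mis (Π⋆ v))` read at `v = F(q₀)`
  have href : (T₀ (bpt L N y j) * star (R' (bpt L N y j - unitVec (fine L N) μ) μ)) (F (bpt L N y j - unitVec (fine L N) μ))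
      = star (Rc (y - unitVec N μ) μ) (lineT L N T₀ R' (y - unitVec N μ) j t μ
          (piTv L N R' (bpt L N (y - unitVec N μ) j + tstep (fine L N) μ t) μ s₀ (F (bpt L N (y - unitVec N μ) j + tstep (fine L N) μ t + tstep (fine L N) μ s₀))))
        + star (Rc (y - unitVec N μ) μ) (misL L N Rc R' (lineT L N T₀ R') (y - unitVec N μ) j t μ μ
            (star (piTv L N R' (bpt L N y j - unitVec (fine L N) μ) μ ((t : ℕ) + 1)) (F (bpt L N y j - unitVec (fine L N) μ)))) := by
    have e := congrArg (fun S : E →L[ℂ] E => S (F (bpt L N y j - unitVec (fine L N) μ))) hid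
    simp only [sub_apply, mul_apply_eq_comp] at e
    rw [hpq]
    rw [eq_sub_iff_add_eq] at e
    exact e.symm
  simp only [href, map_add, map_sum, map_sub, sum_add_distrib, sum_sub_distrib]
  abel

omit [NeZero L] hN in
/-- the norm of the summand: `≤ 2L·Σ_{r<L}‖F₂(p′ + r e_μ)‖ + L·m·‖F(q₀)‖ + m·‖w‖` (for `F = D_μW_μ`). [folklore] -/
theorem norm_summand_le (hRc : ∀ y μ, Rc y μ ∈ unitary (E →L[ℂ] E)) (hR' : ∀ x μ, R' x μ ∈ unitary (E →L[ℂ] E))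
    (hT₀ : ∀ x, T₀ x ∈ unitary (E →L[ℂ] E)) {m : ℝ} (hmis : ∀ y j t μ, ‖misL L N Rc R' (lineT L N T₀ R') y j t μ μ‖ ≤ m)
    (W : Tor (fine L N) → Fin d → E) (y : Tor N) (j : Fin d → Fin L) (μ : Fin d) (t : Fin L) :
    ‖(∑ _s ∈ range L, (T₀ (bpt L N y j) * star (R' (bpt L N y j - unitVec (fine L N) μ) μ)) (cdV (fine L N) R' W (bpt L N y j - unitVec (fine L N) μ) μ μ))
      - star (Rc (y - unitVec N μ) μ) (lineT L N T₀ R' (y - unitVec N μ) j t μ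
          (∑ s ∈ range L, piTv L N R' (bpt L N (y - unitVec N μ) j + tstep (fine L N) μ t) μ s
            (cdV (fine L N) R' W (bpt L N (y - unitVec N μ) j + tstep (fine L N) μ t + tstep (fine L N) μ s) μ μ))
          + misL L N Rc R' (lineT L N T₀ R') (y - unitVec N μ) j t μ μ (W (bpt L N y j + tstep (fine L N) μ t) μ))‖
      ≤ 2 * (L : ℝ) * ∑ r ∈ range L, ‖cdV (fine L N) R' (fun z ν => cdV (fine L N) R' W z μ ν)
            (bpt L N (y - unitVec N μ) j + tstep (fine L N) μ t + tstep (fine L N) μ r) μ μ‖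
        + (L : ℝ) * m * ‖cdV (fine L N) R' W (bpt L N y j - unitVec (fine L N) μ) μ μ‖
        + m * ‖W (bpt L N y j + tstep (fine L N) μ t) μ‖ := by
  have hR'1 : ∀ x μ, ‖R' x μ‖ ≤ 1 := fun x μ => norm_le_one_of_mem_unitary (hR' x μ)
  have hm0 : 0 ≤ m := le_trans (norm_nonneg _) (hmis y j t μ)
  -- `s₀ = L − 1 − t`
  obtain ⟨s₀, hts⟩ : ∃ s₀ : ℕ, s₀ + ((t : ℕ) + 1) = L := ⟨L - ((t : ℕ) + 1), Nat.sub_add_cancel (Nat.succ_le_of_lt t.isLt)⟩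
  have hs₀L : s₀ ≤ L := by omega
  have hse := summand_eq L N (T₀ := T₀) hRc hR' y j μ t hts (fun z => cdV (fine L N) R' W z μ μ) (W (bpt L N y j + tstep (fine L N) μ t) μ)
  rw [hse]
  -- operator norms of the transports
  have hU : ‖star (Rc (y - unitVec N μ) μ)‖ ≤ 1 := by rw [norm_star]; exact norm_le_one_of_mem_unitary (hRc _ _)
  have hTn : ‖lineT L N T₀ R' (y - unitVec N μ) j t μ‖ ≤ 1 := by
    unfold lineT
    calc _ ≤ ‖T₀ (bpt L N (y - unitVec N μ) j)‖ * ‖piTv L N R' (bpt L N (y - unitVec N μ) j) μ t‖ := norm_mul_le _ _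
      _ ≤ 1 * 1 := mul_le_mul (norm_le_one_of_mem_unitary (hT₀ _)) (norm_piTv_le_one L N hR'1 _ _ _) (norm_nonneg _) zero_le_one
      _ = 1 := one_mul 1
  have hPi : ‖star (piTv L N R' (bpt L N y j - unitVec (fine L N) μ) μ ((t : ℕ) + 1))‖ ≤ 1 := by
    rw [norm_star]; exact norm_piTv_le_one L N hR'1 _ _ _
  -- generic: `‖A v‖ ≤ ‖v‖` for `‖A‖ ≤ 1`
  have hle1 : ∀ (A : E →L[ℂ] E) (v : E), ‖A‖ ≤ 1 → ‖A v‖ ≤ ‖v‖ := fun A v hA =>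
    (A.le_opNorm v).trans ((mul_le_mul_of_nonneg_right hA (norm_nonneg v)).trans (by rw [one_mul]))
  have hmis' : ∀ v : E, ‖misL L N Rc R' (lineT L N T₀ R') (y - unitVec N μ) j t μ μ v‖ ≤ m * ‖v‖ := fun v =>
    (ContinuousLinearMap.le_opNorm _ v).trans (mul_le_mul_of_nonneg_right (hmis _ _ _ _) (norm_nonneg v))
  refine (norm_sub_le _ _).trans ?_
  have h3 : ‖star (Rc (y - unitVec N μ) μ) (misL L N Rc R' (lineT L N T₀ R') (y - unitVec N μ) j t μ μ (W (bpt L N y j + tstep (fine L N) μ t) μ))‖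
      ≤ m * ‖W (bpt L N y j + tstep (fine L N) μ t) μ‖ := (hle1 _ _ hU).trans (hmis' _)
  have h12 : ‖∑ s ∈ range L, (star (Rc (y - unitVec N μ) μ) (lineT L N T₀ R' (y - unitVec N μ) j t μ
            (piTv L N R' (bpt L N (y - unitVec N μ) j + tstep (fine L N) μ t) μ s₀
                (cdV (fine L N) R' W (bpt L N (y - unitVec N μ) j + tstep (fine L N) μ t + tstep (fine L N) μ s₀) μ μ)
              - piTv L N R' (bpt L N (y - unitVec N μ) j + tstep (fine L N) μ t) μ s
                (cdV (fine L N) R' W (bpt L N (y - unitVec N μ) j + tstep (fine L N) μ t + tstep (fine L N) μ s) μ μ)))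
          + star (Rc (y - unitVec N μ) μ) (misL L N Rc R' (lineT L N T₀ R') (y - unitVec N μ) j t μ μ
              (star (piTv L N R' (bpt L N y j - unitVec (fine L N) μ) μ ((t : ℕ) + 1)) (cdV (fine L N) R' W (bpt L N y j - unitVec (fine L N) μ) μ μ))))‖
      ≤ 2 * (L : ℝ) * ∑ r ∈ range L, ‖cdV (fine L N) R' (fun z ν => cdV (fine L N) R' W z μ ν)
            (bpt L N (y - unitVec N μ) j + tstep (fine L N) μ t + tstep (fine L N) μ r) μ μ‖
        + (L : ℝ) * m * ‖cdV (fine L N) R' W (bpt L N y j - unitVec (fine L N) μ) μ μ‖ := by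
    refine (norm_sum_le _ _).trans ?_
    have hterm : ∀ s ∈ range L, ‖(star (Rc (y - unitVec N μ) μ) (lineT L N T₀ R' (y - unitVec N μ) j t μ
            (piTv L N R' (bpt L N (y - unitVec N μ) j + tstep (fine L N) μ t) μ s₀
                (cdV (fine L N) R' W (bpt L N (y - unitVec N μ) j + tstep (fine L N) μ t + tstep (fine L N) μ s₀) μ μ)
              - piTv L N R' (bpt L N (y - unitVec N μ) j + tstep (fine L N) μ t) μ s
                (cdV (fine L N) R' W (bpt L N (y - unitVec N μ) j + tstep (fine L N) μ t + tstep (fine L N) μ s) μ μ)))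
          + star (Rc (y - unitVec N μ) μ) (misL L N Rc R' (lineT L N T₀ R') (y - unitVec N μ) j t μ μ
              (star (piTv L N R' (bpt L N y j - unitVec (fine L N) μ) μ ((t : ℕ) + 1)) (cdV (fine L N) R' W (bpt L N y j - unitVec (fine L N) μ) μ μ))))‖
        ≤ 2 * ∑ r ∈ range L, ‖cdV (fine L N) R' (fun z ν => cdV (fine L N) R' W z μ ν)
              (bpt L N (y - unitVec N μ) j + tstep (fine L N) μ t + tstep (fine L N) μ r) μ μ‖
          + m * ‖cdV (fine L N) R' W (bpt L N y j - unitVec (fine L N) μ) μ μ‖ := by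
      intro s hs
      refine (norm_add_le _ _).trans (add_le_add ?_ ?_)
      · refine (hle1 _ _ hU).trans ((hle1 _ _ hTn).trans ?_)
        rw [← norm_neg, neg_sub]
        exact norm_line_window_le L N hR'1 W _ μ (le_of_lt (mem_range.mp hs)) hs₀L
      · exact (hle1 _ _ hU).trans ((hmis' _).trans (mul_le_mul_of_nonneg_left (hle1 _ _ hPi) hm0))
    refine (sum_le_sum hterm).trans (le_of_eq ?_)
    rw [sum_const, card_range, nsmul_eq_mul]
    ring
  linarith [h12, h3]

omit hN in
/-- **DIV-AVG WITH BACKGROUND, THE POINTWISE BOUND** (unitary `Rc`, `R′`, `T₀′`; product line carriers `T = lineT T₀′ R′`; FED⁺'s SITE mismatch `‖misv Rc R′ T₀′ y μ j‖ ≤ m`,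
which IS the line mismatch in the line's own direction — `misL_lineT_self`):
`‖div_{Rc}(Q_T W)(y) − L•Q_{T₀′}(div_{R′} W)(y)‖ ≤ (L^{d+1})⁻¹·Σ_μ Σ_j Σ_t (2L·Σ_{r<L}‖F₂_μ(p′_{μjt} + r e_μ)‖ + L·m·‖F_μ(L·y+j−e_μ)‖ + m·‖W(L·y+j+t e_μ, μ)‖)`,
`p′_{μjt} = L·(y − e_μ) + j + t e_μ`. [folklore] -/
theorem norm_divAvg_cov_le (hRc : ∀ y μ, Rc y μ ∈ unitary (E →L[ℂ] E)) (hR' : ∀ x μ, R' x μ ∈ unitary (E →L[ℂ] E))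
    (hT₀ : ∀ x, T₀ x ∈ unitary (E →L[ℂ] E)) {m : ℝ}
    (hmis : ∀ y μ j, ‖misv L N Rc R' T₀ y μ j‖ ≤ m) (W : Tor (fine L N) → Fin d → E) (y : Tor N) :
    ‖divV N Rc (QvL L N (lineT L N T₀ R') W) y - (L : ℂ) • Qcv L N T₀ (divV (fine L N) R' W) y‖
      ≤ ((L : ℝ) ^ (d + 1))⁻¹ * ∑ μ : Fin d, ∑ j : Fin d → Fin L, ∑ t : Fin L,
          (2 * (L : ℝ) * ∑ r ∈ range L, ‖cdV (fine L N) R' (fun z ν => cdV (fine L N) R' W z μ ν)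
              (bpt L N (y - unitVec N μ) j + tstep (fine L N) μ t + tstep (fine L N) μ r) μ μ‖
            + (L : ℝ) * m * ‖cdV (fine L N) R' W (bpt L N y j - unitVec (fine L N) μ) μ μ‖
            + m * ‖W (bpt L N y j + tstep (fine L N) μ t) μ‖) := by
  have hLne : (L : ℂ) ≠ 0 := by exact_mod_cast NeZero.ne L
  have hmisL : ∀ y j t μ, ‖misL L N Rc R' (lineT L N T₀ R') y j t μ μ‖ ≤ m :=
    norm_misL_lineT_self_le L N (fun x μ => norm_le_one_of_mem_unitary (hR' x μ)) hmis
  -- §a the coarse side: `div_{Rc}(Q_T W)(y) = −Σ_μ Rc(y′)⋆ (cdV Rc (Q_T W) y′ μ μ)` and the line-by-line decomposition at `y′ = y − e_μ`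
  have hcoarse : divV N Rc (QvL L N (lineT L N T₀ R') W) y
      = -∑ μ : Fin d, star (Rc (y - unitVec N μ) μ) ((((L : ℂ) ^ (d + 1))⁻¹ : ℂ) • ∑ j : Fin d → Fin L, ∑ t : Fin L,
          (lineT L N T₀ R' (y - unitVec N μ) j t μ (∑ s ∈ range L, piTv L N R' (bpt L N (y - unitVec N μ) j + tstep (fine L N) μ t) μ s
              (cdV (fine L N) R' W (bpt L N (y - unitVec N μ) j + tstep (fine L N) μ t + tstep (fine L N) μ s) μ μ))
            + misL L N Rc R' (lineT L N T₀ R') (y - unitVec N μ) j t μ μ (W (bpt L N y j + tstep (fine L N) μ t) μ))) := by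
    rw [divV_eq_neg_sum Rc hRc]
    congr 1
    refine sum_congr rfl fun μ _ => ?_
    rw [cdV_QvL_eq L N Rc (lineT L N T₀ R') W (y - unitVec N μ) μ μ]
    congr 2
    refine sum_congr rfl fun j _ => sum_congr rfl fun t _ => ?_
    rw [line_decomp L N Rc R' (lineT L N T₀ R') W (y - unitVec N μ) j t μ μ, point_eq' L N y j μ t]
  -- §b the fine side: `L•Q₀(div′ W)(y) = −(L^{d+1})⁻¹ • Σ_μ Σ_j Σ_t Σ_{s<L} Tref (F_μ(b_j − e_μ))`
  have hfine : (L : ℂ) • Qcv L N T₀ (divV (fine L N) R' W) y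
      = -((((L : ℂ) ^ (d + 1))⁻¹ : ℂ) • ∑ μ : Fin d, ∑ j : Fin d → Fin L, ∑ _t : Fin L, ∑ _s ∈ range L,
          (T₀ (bpt L N y j) * star (R' (bpt L N y j - unitVec (fine L N) μ) μ)) (cdV (fine L N) R' W (bpt L N y j - unitVec (fine L N) μ) μ μ)) := by
    have hconst : ∀ c : E, (∑ _t : Fin L, ∑ _s ∈ range L, c) = ((L : ℂ) * L) • c := fun c => by
      rw [sum_const, sum_const, card_range, Finset.card_univ, Fintype.card_fin, smul_smul, ← Nat.cast_smul_eq_nsmul ℂ, Nat.cast_mul]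
    unfold Qcv
    simp only [divV_eq_neg_sum R' hR', map_neg, map_sum, mul_apply_eq_comp, hconst, sum_neg_distrib, smul_neg, ← smul_sum, smul_smul]
    rw [Finset.sum_comm]
    congr 2
    rw [pow_succ]
    field_simp
  -- §c the difference is `(L^{d+1})⁻¹ •` the sum of the summands of `norm_summand_le`
  have hdiff : divV N Rc (QvL L N (lineT L N T₀ R') W) y - (L : ℂ) • Qcv L N T₀ (divV (fine L N) R' W) y
      = (((L : ℂ) ^ (d + 1))⁻¹ : ℂ) • ∑ μ : Fin d, ∑ j : Fin d → Fin L, ∑ t : Fin L,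
          ((∑ _s ∈ range L, (T₀ (bpt L N y j) * star (R' (bpt L N y j - unitVec (fine L N) μ) μ)) (cdV (fine L N) R' W (bpt L N y j - unitVec (fine L N) μ) μ μ))
            - star (Rc (y - unitVec N μ) μ) (lineT L N T₀ R' (y - unitVec N μ) j t μ
                (∑ s ∈ range L, piTv L N R' (bpt L N (y - unitVec N μ) j + tstep (fine L N) μ t) μ s
                  (cdV (fine L N) R' W (bpt L N (y - unitVec N μ) j + tstep (fine L N) μ t + tstep (fine L N) μ s) μ μ))
                + misL L N Rc R' (lineT L N T₀ R') (y - unitVec N μ) j t μ μ (W (bpt L N y j + tstep (fine L N) μ t) μ))) := by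
    -- linearity of the frame operators, with the summand kept opaque
    have hlin : ∀ (U : E →L[ℂ] E) (c : ℂ) (X : (Fin d → Fin L) → Fin L → E),
        U (c • ∑ j : Fin d → Fin L, ∑ t : Fin L, X j t) = c • ∑ j : Fin d → Fin L, ∑ t : Fin L, U (X j t) := fun U c X => by
      rw [map_smul, map_sum]
      simp only [map_sum]
    rw [hcoarse, hfine, sub_neg_eq_add, neg_add_eq_sub]
    simp only [hlin]
    rw [← smul_sum, ← smul_sub]
    congr 1
    simp only [sum_sub_distrib]
  rw [hdiff, norm_smul, norm_inv, norm_pow, Complex.norm_natCast]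
  refine mul_le_mul_of_nonneg_left ?_ (by positivity)
  refine (norm_sum_le _ _).trans (sum_le_sum fun μ _ => (norm_sum_le _ _).trans (sum_le_sum fun j _ =>
    (norm_sum_le _ _).trans (sum_le_sum fun t _ => norm_summand_le L N hRc hR' hT₀ hmisL W y j μ t)))

end Pointwise

end Summit.QuantumFields.BalabanUV.T4Continuum.VariationalVectorDivAvgCovariant

end
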